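import Literature.Analysis.ODE.HeunEulerKernel
import HarnessLib

/-!
# A Möbius automorphism of Heun's equation: `x = a(z−1)/z`, `v(z) = z^{−β} y(x)`

Topic `Literature/Analysis/ODE` (namespace `Literature.Analysis.ODE`, sub-namespace `GeneralHeun`;
Umetsu's normalisation `M = lead ∂² + mid ∂ + low`, `low = αβ·x + q`, as in `HeunDerivative.lean`).

R. S. Maier, *The 192 solutions of the Heun equation*, Math. Comp. 76 (2007) 811–843
[Maier2007Heun192], §3–§4: the automorphism group of Heun's equation is generated by the `4! = 24`
Möbius maps permuting the singular points `{0, 1, a, ∞}` (each with an induced change of the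
parameter `a` and of `(γ,δ,ε;α,β;q)`) together with the index-shifting gauge factors
`x^{1−γ}`, `(x−1)^{1−δ}`, `(x−a)^{1−ε}`. This file PROVES one of these transformations, the one
needed to pass from a Heun equation with singular points `(0, 1, a, ∞)` to the one with the same
points relabelled `(1, a/(a−1), ∞, 0)`:

* if `y` solves `Hn(a; γ,δ,ε; α,β; q)` (classically, at the point `x = a(z−1)/z`), then
  `v(z) := z^{−β}·y(a(z−1)/z)` solves `Hn(a/(a−1); 1+β−α, γ, δ; β, β+1−ε; q′)` at `z`, with
  `q′ = β(α − δ − γ·a/(a−1)) − q/(a−1)` (Umetsu's sign of `q`), under the Fuchs relation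
  `γ+δ+ε = α+β+1` — as the POINTWISE identity `heun_mobius_identity`
  `lead_{a′}(z)·v₂ + mid′(z)·v₁ + low′(z)·v = −z^{−β}/(a−1) · [lead_a(x)·y₂ + mid(x)·y₁ + low(x)·y]`
  between the closed forms `v, v₁, v₂` (`mobiusV`, `mobiusV₁`, `mobiusV₂`) of `v` and its first two
  `z`-derivatives (`hasDerivAt_mobiusV`, `hasDerivAt_mobiusV₁`), valid for every twice-differentiable
  `y`; hence the solution statement `isSolution_mobius` (exponent bookkeeping: the local exponents
  `{0,1−γ}` at `x = 0` go to `z = 1`, `{0,1−δ}` at `x = 1` go to `z = a/(a−1)`, `{0,1−ε}` at `x = a`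
  go to `z = ∞` where the factor `z^{−β}` makes them `{β, β+1−ε}`, and `{α,β}` at `x = ∞` go to
  `z = 0` where they become `{α−β, 0}`, i.e. `γ′ = 1+β−α`).

Motivation (recorded, not used): it carries the Kerr–de Sitter radial Heun equation in Hatsuda's
variable (`z_H`: `r₊ ↦ 0`, `r_c ↦ 1`, `r₋' ↦ z_r`, `r₋ ↦ ∞`; tree file `KerrDeSitterHeunForm`) to
Casals–Teixeira da Costa's variable (`r₋ ↦ 0`, `r₊ ↦ 1`, `r_c ↦ z₂ = z_r/(z_r−1)`, `r₋' ↦ ∞`) in the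
Euler gauge of `KerrDeSitterHiddenSymmetryKernel` (with `β = σ₋`). Powers of the positive real `z`
are `GeneralHeun.eulerKernel β z = z^{−β}`. No named facts; everything is proved.

## References
* R. S. Maier, Math. Comp. 76 (2007) 811–843, arXiv:math/0408317, §3 (automorphism group),
  Table 2. Key `Maier2007Heun192`.
* H. Umetsu, Prog. Theor. Phys. 104 (2000) 743–755, §3 (normalisation). Key `Umetsu2000`.
-/

noncomputable section

open Set Filter
open scoped Topology

namespace Literature.Analysis.ODE

namespace GeneralHeun

/-! ### The substitution and the image parameters -/

/-- The Möbius substitution `x = a(z−1)/z` (so `z = 1 ↦ x = 0`, `z = a/(a−1) ↦ x = 1`,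
`z = ∞ ↦ x = a`, `z = 0 ↦ x = ∞`). [cite: Maier2007Heun192, §3] -/
def mobiusX (a z : ℝ) : ℝ := a * (z - 1) / z

/-- The image singular-point parameter `a′ = a/(a−1)`. [cite: Maier2007Heun192, §3] -/
def mobiusA (a : ℝ) : ℝ := a / (a - 1)

/-- The image `γ′ = 1 + β − α` (exponent difference at `z = 0`, coming from `x = ∞`).
[cite: Maier2007Heun192, §3] -/
def mobiusγ (α β : ℂ) : ℂ := 1 + β - α

/-- The image `β′ = β + 1 − ε` (second exponent at `z = ∞`, coming from `x = a`).
[cite: Maier2007Heun192, §3] -/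
def mobiusβ (β ε : ℂ) : ℂ := β + 1 - ε

/-- The image accessory parameter (Umetsu's sign): `q′ = β(α − δ − γ·a/(a−1)) − q/(a−1)`.
[cite: Maier2007Heun192, §3] -/
def mobiusQ (a : ℝ) (α β γ δ q : ℂ) : ℂ :=
  β * (α - δ - γ * ((a / (a - 1) : ℝ) : ℂ)) - q / ((a : ℂ) - 1)

/-- The image parameters satisfy the Fuchs relation (`δ′ = γ`, `ε′ = δ`, `α′ = β`).
[cite: Maier2007Heun192, §3] -/
theorem mobius_fuchs {α β γ δ ε : ℂ} (hF : γ + δ + ε = α + β + 1) :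
    mobiusγ α β + γ + δ = β + mobiusβ β ε + 1 := by
  unfold mobiusγ mobiusβ
  linear_combination hF

/-! ### Closed forms of `v = z^{−β} y(x)` and its derivatives -/

/-- `v(z) = z^{−β}·y(a(z−1)/z)`. [cite: Maier2007Heun192, §3] -/
def mobiusV (a : ℝ) (β : ℂ) (y : ℝ → ℂ) (z : ℝ) : ℂ :=
  eulerKernel β z * y (mobiusX a z)

/-- `v′(z) = z^{−β}·[−β z⁻¹ y(x) + a z⁻² y′(x)]`. [cite: Maier2007Heun192, §3] -/
def mobiusV₁ (a : ℝ) (β : ℂ) (y y₁ : ℝ → ℂ) (z : ℝ) : ℂ :=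
  eulerKernel β z *
    (-β * ((z : ℂ))⁻¹ * y (mobiusX a z) + (a : ℂ) * ((z : ℂ))⁻¹ ^ 2 * y₁ (mobiusX a z))

/-- `v″(z) = z^{−β}·[β(β+1) z⁻² y(x) − 2(β+1) a z⁻³ y′(x) + a² z⁻⁴ y″(x)]`.
[cite: Maier2007Heun192, §3] -/
def mobiusV₂ (a : ℝ) (β : ℂ) (y y₁ y₂ : ℝ → ℂ) (z : ℝ) : ℂ :=
  eulerKernel β z *
    (β * (β + 1) * ((z : ℂ))⁻¹ ^ 2 * y (mobiusX a z)
      - 2 * (β + 1) * (a : ℂ) * ((z : ℂ))⁻¹ ^ 3 * y₁ (mobiusX a z)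
      + (a : ℂ) ^ 2 * ((z : ℂ))⁻¹ ^ 4 * y₂ (mobiusX a z))

/-- `d/dz [a(z−1)/z] = a/z²` for `z ≠ 0`. [cite: Maier2007Heun192, §3] -/
theorem hasDerivAt_mobiusX (a : ℝ) {z : ℝ} (hz : z ≠ 0) :
    HasDerivAt (mobiusX a) (a / z ^ 2) z := by
  unfold mobiusX
  have h1 : HasDerivAt (fun w : ℝ => a * (w - 1)) (a * 1) z :=
    ((hasDerivAt_id' z).sub_const 1).const_mul a
  have h := h1.div (hasDerivAt_id' z) hz
  refine h.congr_deriv ?_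
  field_simp
  ring

/-- First derivative of `v`: `HasDerivAt (mobiusV a β y) (mobiusV₁ a β y y₁ z) z` for `z > 0`,
given the derivative of `y` at `x = a(z−1)/z`. [cite: Maier2007Heun192, §3] -/
theorem hasDerivAt_mobiusV {a : ℝ} {β : ℂ} {y y₁ : ℝ → ℂ} {z : ℝ} (hz : 0 < z)
    (hy : HasDerivAt y (y₁ (mobiusX a z)) (mobiusX a z)) :
    HasDerivAt (mobiusV a β y) (mobiusV₁ a β y y₁ z) z := by
  have hK := hasDerivAt_eulerKernel β hz
  have hs := mul_eulerKernel_succ β hz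
  have hX := hasDerivAt_mobiusX a hz.ne'
  have hY : HasDerivAt (fun w : ℝ => y (mobiusX a w)) ((a / z ^ 2) • y₁ (mobiusX a z)) z :=
    hy.scomp z hX
  have h := hK.mul hY
  unfold mobiusV mobiusV₁
  refine h.congr_deriv ?_
  have hz' : (z : ℂ) ≠ 0 := by exact_mod_cast hz.ne'
  have hk1 : eulerKernel (β + 1) z = eulerKernel β z * ((z : ℂ))⁻¹ := by
    rw [← hs]; field_simp
  rw [Complex.real_smul, hk1]
  push_cast
  field_simp

/-- Second derivative of `v`: `HasDerivAt (mobiusV₁ a β y y₁) (mobiusV₂ a β y y₁ y₂ z) z` for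
`z > 0`, given the derivatives of `y` and `y₁` at `x`. [cite: Maier2007Heun192, §3] -/
theorem hasDerivAt_mobiusV₁ {a : ℝ} {β : ℂ} {y y₁ y₂ : ℝ → ℂ} {z : ℝ} (hz : 0 < z)
    (hy : HasDerivAt y (y₁ (mobiusX a z)) (mobiusX a z))
    (hy₁ : HasDerivAt y₁ (y₂ (mobiusX a z)) (mobiusX a z)) :
    HasDerivAt (mobiusV₁ a β y y₁) (mobiusV₂ a β y y₁ y₂ z) z := by
  have hK := hasDerivAt_eulerKernel β hz
  have hs := mul_eulerKernel_succ β hz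
  have hX := hasDerivAt_mobiusX a hz.ne'
  have hY : HasDerivAt (fun w : ℝ => y (mobiusX a w)) ((a / z ^ 2) • y₁ (mobiusX a z)) z :=
    hy.scomp z hX
  have hY₁ : HasDerivAt (fun w : ℝ => y₁ (mobiusX a w)) ((a / z ^ 2) • y₂ (mobiusX a z)) z :=
    hy₁.scomp z hX
  have hz' : (z : ℂ) ≠ 0 := by exact_mod_cast hz.ne'
  have hc : HasDerivAt (fun w : ℝ => (w : ℂ)) 1 z := by
    simpa using (hasDerivAt_id z).ofReal_comp
  have hinv : HasDerivAt (fun w : ℝ => ((w : ℂ))⁻¹) (-(((z : ℂ))⁻¹ ^ 2)) z := by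
    have h1 : HasDerivAt (fun w : ℝ => w⁻¹) (-(z ^ 2)⁻¹) z := hasDerivAt_inv hz.ne'
    have h2 := h1.ofReal_comp
    have e1 : (fun w : ℝ => ((w⁻¹ : ℝ) : ℂ)) = fun w : ℝ => ((w : ℂ))⁻¹ := by
      funext w; push_cast; ring
    rw [e1] at h2
    refine h2.congr_deriv ?_
    push_cast
    ring
  have hinv2 := hinv.pow 2
  -- the bracket B(w) = −β w⁻¹ y(x) + a w⁻² y₁(x)
  have hB := ((hinv.const_mul (-β)).mul hY).add ((hinv2.const_mul (a : ℂ)).mul hY₁)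
  have h := hK.mul hB
  unfold mobiusV₁ mobiusV₂
  refine h.congr_deriv ?_
  have hk1 : eulerKernel (β + 1) z = eulerKernel β z * ((z : ℂ))⁻¹ := by
    rw [← hs]; field_simp
  simp only [Pi.mul_apply, Pi.add_apply, Pi.pow_apply, Complex.real_smul]
  rw [hk1]
  push_cast
  field_simp
  ring

/-! ### The identity and the solution statement -/

/-- **Möbius automorphism `x = a(z−1)/z` of Heun's equation — the pointwise identity.** For any
values `y, y₁, y₂` of a function and its first two derivatives at `x = a(z−1)/z` (`z ≠ 0`,
`a ≠ 1`), with `v, v₁, v₂` the closed forms of `z^{−β}y(x)` and its `z`-derivatives, and Heun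
parameters with the Fuchs relation:
`lead_{a′}(z) v₂ + mid_{γ′,γ,δ}(z) v₁ + (β β′ z + q′) v = −z^{−β}/(a−1)·[lead_a(x) y₂ + mid_{γδε}(x) y₁ + (αβ x + q) y]`,
`a′ = a/(a−1)`, `γ′ = 1+β−α`, `β′ = β+1−ε`, `q′ = β(α−δ−γa′) − q/(a−1)`.
[cite: Maier2007Heun192, §3 (Table 2)] -/
theorem heun_mobius_identity {α β γ δ ε q : ℂ} (hF : γ + δ + ε = α + β + 1) {a z : ℝ}
    (ha : a ≠ 1) (hz : z ≠ 0) (y y₁ y₂ : ℝ → ℂ) :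
    lead (mobiusA a : ℂ) z * mobiusV₂ a β y y₁ y₂ z +
        mid (mobiusA a : ℂ) (mobiusγ α β) γ δ z * mobiusV₁ a β y y₁ z +
        low β (mobiusβ β ε) (mobiusQ a α β γ δ q) z * mobiusV a β y z =
      -(eulerKernel β z) / ((a : ℂ) - 1) *
        (lead (a : ℂ) (mobiusX a z) * y₂ (mobiusX a z) +
          mid (a : ℂ) γ δ ε (mobiusX a z) * y₁ (mobiusX a z) +
          low α β q (mobiusX a z) * y (mobiusX a z)) := by
  have hε : ε = α + β + 1 - γ - δ := by linear_combination hF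
  subst hε
  have hz' : (z : ℂ) ≠ 0 := by exact_mod_cast hz
  have ha' : (a : ℂ) - 1 ≠ 0 := sub_ne_zero.mpr (by exact_mod_cast ha)
  have ha'' : ((a - 1 : ℝ) : ℂ) ≠ 0 := by push_cast; exact ha'
  unfold mobiusV mobiusV₁ mobiusV₂ mobiusA mobiusγ mobiusβ mobiusQ mobiusX lead mid low
  push_cast
  field_simp
  ring

/-- **Solution statement.** If `y` solves Heun's equation `Hn(a; γ,δ,ε; α,β; q)` at the point
`x = a(z−1)/z` (values `y, y₁ x, y₂ x` with `lead·y₂ + mid·y₁ + low·y = 0` there) and is twice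
differentiable there, then `v = z^{−β}y(a(·−1)/·)` is twice differentiable at `z > 0` with
`lead_{a′} v″ + mid′ v′ + low′ v = 0` there (`a ≠ 1`, Fuchs). [cite: Maier2007Heun192, §3 (Table 2)] -/
theorem isSolutionAt_mobius {α β γ δ ε q : ℂ} (hF : γ + δ + ε = α + β + 1) {a z : ℝ}
    (ha : a ≠ 1) (hz : 0 < z) {y y₁ y₂ : ℝ → ℂ}
    (hy : HasDerivAt y (y₁ (mobiusX a z)) (mobiusX a z))
    (hy₁ : HasDerivAt y₁ (y₂ (mobiusX a z)) (mobiusX a z))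
    (hsol : lead (a : ℂ) (mobiusX a z) * y₂ (mobiusX a z) +
        mid (a : ℂ) γ δ ε (mobiusX a z) * y₁ (mobiusX a z) + low α β q (mobiusX a z) * y (mobiusX a z) = 0) :
    HasDerivAt (mobiusV a β y) (mobiusV₁ a β y y₁ z) z ∧
      HasDerivAt (mobiusV₁ a β y y₁) (mobiusV₂ a β y y₁ y₂ z) z ∧
      lead (mobiusA a : ℂ) z * mobiusV₂ a β y y₁ y₂ z +
          mid (mobiusA a : ℂ) (mobiusγ α β) γ δ z * mobiusV₁ a β y y₁ z +
          low β (mobiusβ β ε) (mobiusQ a α β γ δ q) z * mobiusV a β y z = 0 := by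
  refine ⟨hasDerivAt_mobiusV hz hy, hasDerivAt_mobiusV₁ hz hy hy₁, ?_⟩
  rw [heun_mobius_identity hF ha hz.ne' y y₁ y₂, hsol, mul_zero]

/-- **On a set.** If `y` is a classical solution of `Hn(a; γ,δ,ε; α,β; q)` on `U ⊆ ℝ`
(`GeneralHeun.IsSolutionOn`), then `z ↦ z^{−β} y(a(z−1)/z)` is a classical solution of
`Hn(a/(a−1); 1+β−α, γ, δ; β, β+1−ε; q′)` on any set `V` of positive reals mapped into `U` by
`z ↦ a(z−1)/z`. [cite: Maier2007Heun192, §3 (Table 2)] -/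
theorem isSolutionOn_mobius {α β γ δ ε q : ℂ} (hF : γ + δ + ε = α + β + 1) {a : ℝ} (ha : a ≠ 1)
    {U V : Set ℝ} (hV : ∀ z ∈ V, 0 < z ∧ mobiusX a z ∈ U) {y : ℝ → ℂ}
    (hy : IsSolutionOn (a : ℂ) α β γ δ ε q U y) :
    IsSolutionOn (mobiusA a : ℂ) β (mobiusβ β ε) (mobiusγ α β) γ δ (mobiusQ a α β γ δ q) V
      (mobiusV a β y) := by
  obtain ⟨y₁, y₂, h⟩ := hy
  refine ⟨mobiusV₁ a β y y₁, mobiusV₂ a β y y₁ y₂, fun z hz => ?_⟩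
  obtain ⟨hzpos, hxU⟩ := hV z hz
  obtain ⟨hd, hd₁, heq⟩ := h (mobiusX a z) hxU
  exact isSolutionAt_mobius hF ha hzpos hd hd₁ heq

end GeneralHeun

end Literature.Analysis.ODE
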